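import Mathlib
import HarnessLib
import Literature.Analysis.FluidPDE.VectorCalculus
import Summits.NavierStokesRegularity.NavierStokesRegularity.Theorems.UnthreadedRigidityDoorUnthreadedRigidityVirialHornZonal
import Summits.NavierStokesRegularity.NavierStokesRegularity.Theorems.UnthreadedRigidityDoorUnthreadedRigidityVirialHornAngularTwo
import Summits.NavierStokesRegularity.NavierStokesRegularity.Theorems.UnthreadedRigidityDoorUnthreadedRigidityMixedPairDefs

/-!
# Route `UnthreadedRigidityDoor`, item `UnthreadedRigidity` (W2, stmt-NavierStokesRegularity-27585) — LINE g11-2 «MIXED PAIR»: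
# the supports S-D `DipoleShellAxisym`, S-QU `UniaxialQuadShellAxisym`, S-L `OrderOneSilenceLinks` BY NAME

Prover file (engine-1 g71, DIRECTOR-NS dss_147 (3); `--supports stmt-NavierStokesRegularity-27585 --as helper`) for LINE g11-2 «MIXED PAIR» of
planner ns-idea-6 g11/g12 (objects BY NAME in `…MixedPairDefs.lean`).
* `isSolidHarmonic_dipoleHarmonic`: `y ↦ ⟪a,y⟫` is a degree-one solid harmonic; `isSolidHarmonic_axisForm` / `isZonal_axisForm`: an axis form
  `α|y|² + δ⟪n,y⟫²` with `3α + δ|n|² = 0` is a degree-two solid harmonic, zonal about `n` (via g10-2/g11-1's `isSolidHarmonic_quadY`,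
  `hasGradientAt_axisForm`);
* ★ `dipoleShellAxisym_holds : DipoleShellAxisym` (S-D) and ★ `uniaxialQuadShellAxisym_holds : UniaxialQuadShellAxisym` (S-QU): both are
  instances of S-Z `VirialHorn.zonalShellAxisym_holds` (degree one: every solid harmonic is zonal, `angularLemma_one`; uniaxial quadrupole
  `c(3⟪b,y⟫² − |b|²|y|²)` = an axis form about `b`);
* ★ `orderOneSilenceLinks_holds : OrderOneSilenceLinks` (S-L): not coaxial ⇒ `det[y₀, a, Qy₀] ≠ 0` at some `y₀ ≠ 0` ⇒ (degree-two homogeneity,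
  `det3_smul_smul`) nonzero at `(r/|y₀|) y₀` on every sphere ⇒ the radial factor `H₁K₂ − 3H₂K₁` vanishes on `(0,∞)`.

HONEST LABEL: supports of a RUNG line about SPECIAL two-shell data; `UnthreadedRigidity` (27585), W2 and NS regularity remain OPEN; nothing here is a
statement about the Navier–Stokes equations.  0 kit.
-/

-- the summit and its single sub-problem share the name (CONVENTIONS §1), as in every Theorems file
set_option linter.dupNamespace false

namespace Summit.NavierStokesRegularity.NavierStokesRegularity.Theorems.UnthreadedRigidity.MixedPair

open scoped Topology InnerProductSpace
open Filter Set
open Summit.NavierStokesRegularity.NavierStokesRegularity.Theorems.UnthreadedRigidity.ProfileHorn (E3 threadingFlux IsSliceAxisymmetric)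
open Summit.NavierStokesRegularity.NavierStokesRegularity.Theorems.UnthreadedRigidity.VirialHorn (e det3 vortAmpL VirialAdmissible sepShellL
  WindowAxisUniform)

/-! ## Degree-one and uniaxial degree-two solid harmonics -/

section Harmonics

open Summit.NavierStokesRegularity.NavierStokesRegularity.Theorems.UnthreadedRigidity.VirialHorn

/-- the inner product in coordinates (private copy). -/
private theorem real_inner_e3 (u v : E3) : ⟪u, v⟫_ℝ = u 0 * v 0 + u 1 * v 1 + u 2 * v 2 := by
  simp [PiLp.inner_apply, Fin.sum_univ_three, mul_comm]

/-- `‖y‖² = Σ yᵢ²` (private copy). -/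
private theorem norm_sq_e3 (y : E3) : ‖y‖ ^ 2 = y 0 * y 0 + y 1 * y 1 + y 2 * y 2 := by
  rw [← real_inner_self_eq_norm_sq, real_inner_e3]

/-- the dipole harmonic `y ↦ ⟪a, y⟫` is a solid harmonic of degree one. -/
theorem isSolidHarmonic_dipoleHarmonic (a : E3) : IsSolidHarmonic 1 (dipoleHarmonic a) := by
  refine ⟨⟨∑ i : Fin 3, MvPolynomial.C (a i) * MvPolynomial.X i, ?_, fun y => ?_⟩, fun y => ?_⟩
  · refine MvPolynomial.IsHomogeneous.sum _ _ 1 fun i _ => ?_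
    simpa using (MvPolynomial.isHomogeneous_C (Fin 3) (a i)).mul (MvPolynomial.isHomogeneous_X ℝ i)
  · rw [dipoleHarmonic, real_inner_e3]
    simp [Fin.sum_univ_three]
  · -- the second derivatives of a linear form vanish
    unfold lap3 dir2
    have hlin : ∀ v : E3, (fun z : E3 => fderiv ℝ (dipoleHarmonic a) z v) = fun _ => ⟪a, v⟫_ℝ := by
      intro v; funext z
      have : dipoleHarmonic a = fun y : E3 => (innerSL ℝ a) y := by funext y; rfl
      rw [this, (innerSL ℝ a).fderiv]
      rfl
    simp [hlin]

/-- an AXIS FORM `y ↦ α‖y‖² + δ⟪n,y⟫²` with `3α + δ‖n‖² = 0` is a solid harmonic of degree two (it is `Y_M` for the symmetric traceless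
matrix `M = αI + δ n nᵀ`). -/
theorem isSolidHarmonic_axisForm (α δ : ℝ) (n : E3) (h : 3 * α + δ * ‖n‖ ^ 2 = 0) :
    IsSolidHarmonic 2 (fun y : E3 => α * ‖y‖ ^ 2 + δ * ⟪n, y⟫_ℝ ^ 2) := by
  set M : Matrix (Fin 3) (Fin 3) ℝ := Matrix.of fun i j => δ * (n i * n j) + if i = j then α else 0 with hM
  have hQ : ProfileHorn.IsQuadForm M := by
    constructor
    · ext i j
      simp only [hM, Matrix.transpose_apply, Matrix.of_apply]
      by_cases hij : i = j
      · subst hij; rfl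
      · rw [if_neg hij, if_neg (Ne.symm hij)]; ring
    · rw [Matrix.trace_fin_three]
      simp only [hM, Matrix.of_apply, if_true]
      rw [norm_sq_e3] at h
      linear_combination h
  have hfun : (fun y : E3 => α * ‖y‖ ^ 2 + δ * ⟪n, y⟫_ℝ ^ 2) = ProfileHorn.quadY M := by
    funext y
    rw [norm_sq_e3, real_inner_e3]
    simp only [ProfileHorn.quadY, hM, Matrix.of_apply, Fin.sum_univ_three]
    simp
    ring
  rw [hfun]
  exact isSolidHarmonic_quadY hQ

/-- an axis form is zonal about its axis (or about any axis when `n = 0`: then it is radial). -/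
theorem isZonal_axisForm (α δ : ℝ) (n : E3) : IsZonal (fun y : E3 => α * ‖y‖ ^ 2 + δ * ⟪n, y⟫_ℝ ^ 2) := by
  by_cases hn : n = 0
  · refine ⟨e 0, by simp [e], fun y => ?_⟩
    rw [(hasGradientAt_axisForm α δ n y).gradient, hn]
    simp only [det3, PiLp.add_apply, PiLp.smul_apply, smul_eq_mul, inner_zero_left]
    simp
    ring
  · refine ⟨n, hn, fun y => ?_⟩
    rw [(hasGradientAt_axisForm α δ n y).gradient]
    simp only [det3, PiLp.add_apply, PiLp.smul_apply, smul_eq_mul]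
    ring

end Harmonics

/-! ## The supports S-D, S-QU, S-L by name -/

section Supports

open Summit.NavierStokesRegularity.NavierStokesRegularity.Theorems.UnthreadedRigidity.VirialHorn

/-- **S-D `DipoleShellAxisym` BY NAME**: a dipole shell `curl curl (H(|y|) ⟪a,y⟫ y)` is an axisymmetric slice about `x₀` (the degree-one
instance of S-Z `zonalShellAxisym_holds`; every degree-one solid harmonic is zonal, `angularLemma_one`). -/
theorem dipoleShellAxisym_holds : DipoleShellAxisym := by
  intro H₁ a x₀ _ha hH
  have hY : IsSolidHarmonic 1 (dipoleHarmonic a) := isSolidHarmonic_dipoleHarmonic a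
  exact zonalShellAxisym_holds 1 H₁ (dipoleHarmonic a) x₀ hY (angularLemma_one _ hY) hH

/-- **S-QU `UniaxialQuadShellAxisym` BY NAME**: a uniaxial quadrupole shell `curl curl (c H(|y|)(3⟪b,y⟫² − |b|²|y|²) y)` is an axisymmetric
slice about `x₀` (the degree-two instance of S-Z about the quadrupole's own axis `b`). -/
theorem uniaxialQuadShellAxisym_holds : UniaxialQuadShellAxisym := by
  intro Q H x₀ hU hH
  obtain ⟨b, c, _hb, hq⟩ := hU
  have hfun : quadHarmonic Q = fun y : E3 => (-(c * ‖b‖ ^ 2)) * ‖y‖ ^ 2 + (3 * c) * ⟪b, y⟫_ℝ ^ 2 := by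
    funext y; rw [hq y]; ring
  have hY : IsSolidHarmonic 2 (quadHarmonic Q) := by
    rw [hfun]
    exact isSolidHarmonic_axisForm _ _ b (by ring)
  have hZ : IsZonal (quadHarmonic Q) := by
    rw [hfun]
    exact isZonal_axisForm _ _ b
  exact zonalShellAxisym_holds 2 H (quadHarmonic Q) x₀ hY hZ hH

/-- `det[s•u, a, s•w] = s² det[u, a, w]`. -/
private theorem det3_smul_smul (s : ℝ) (u a w : E3) : det3 (s • u) a (s • w) = s ^ 2 * det3 u a w := by
  simp only [det3, PiLp.smul_apply, smul_eq_mul]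
  ring

/-- **S-L `OrderOneSilenceLinks` BY NAME**: if the pair is not coaxial, the quadratic form `y ↦ det[y, a, Qy]` is nonzero at some `y₀ ≠ 0`, hence
(by homogeneity) at a point of every sphere `|y| = r`, so order-one silence `(H₁K₂ − 3H₂K₁)(|y|)·det[y,a,Qy] ≡ 0` forces `H₁K₂ = 3H₂K₁` on `(0,∞)`. -/
theorem orderOneSilenceLinks_holds : OrderOneSilenceLinks := by
  intro H₁ H₂ a Q _hadm hnco hsil r hr
  obtain ⟨y₀, hy₀⟩ : ∃ y₀ : E3, det3 y₀ a (Q y₀) ≠ 0 := by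
    by_contra h
    push Not at h
    exact hnco h
  have hy0 : y₀ ≠ 0 := by
    rintro rfl
    apply hy₀
    simp [det3]
  have hn0 : 0 < ‖y₀‖ := norm_pos_iff.mpr hy0
  set s : ℝ := r / ‖y₀‖ with hs
  have hs0 : 0 < s := div_pos hr hn0
  set y : E3 := s • y₀ with hy
  have hnorm : ‖y‖ = r := by
    rw [hy, norm_smul, Real.norm_eq_abs, abs_of_pos hs0, hs, div_mul_cancel₀ r hn0.ne']
  have hdet : det3 y a (Q y) ≠ 0 := by
    rw [hy, map_smul, det3_smul_smul]
    exact mul_ne_zero (pow_ne_zero 2 hs0.ne') hy₀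
  have key := hsil y
  rw [hnorm] at key
  have hfac : H₁ r * vortAmpL 2 H₂ r - 3 * (H₂ r * vortAmpL 1 H₁ r) = 0 := (mul_eq_zero.mp key).resolve_right hdet
  exact sub_eq_zero.mp hfac

end Supports

end Summit.NavierStokesRegularity.NavierStokesRegularity.Theorems.UnthreadedRigidity.MixedPair
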